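import Literature.Barriers.Parity.SiegelZeroDichotomyPairHLStepTwo
import Literature.NumberTheory.Sieve.PolynomialCongruencesRoughAP
import HarnessLib

/-!
# Tao–Teräväinen 2022, Lemma 3.4 at `k = 2`: expanding the Selberg sieve correlation and the
# Chinese remainder theorem

Topic `Literature/Barriers/Parity`, sub-namespace `TaoTeravainen`; first file of the proof of
Lemma 3.4 of Tao–Teräväinen (*The Hardy–Littlewood–Chowla conjecture in the presence of a Siegel
zero*, J. London Math. Soc. 106 (2022), arXiv:2109.06291) in the case `k = 2`, `ℓ' = 0` needed by the
named facts `TaoTeravainen2021_eq57_pair`, `_eq58_pair` ((5.7), (5.8) of the proof of Proposition 5.2;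
`SiegelZeroDichotomyPairHLStepTwo.lean`) on the way to `TaoTeravainen2021_pairHL`. Everything here is
PROVED and elementary; the analytic part (Fourier expansion (3.16), Euler products, the pointwise
bound) is in the sequels.

Lemma 3.4 (Selberg sieve concentrates on almost primes): "Let `0 ≤ ℓ' ≤ ℓ`, and let
`1 ≤ d₁,…,d_k,d'₁,…,d'_{ℓ'} ≤ x` be integers. Then
`𝔼_{n ≤ x} ∏_{j=1}^k ν(n+h_j) 1_{d_j∣n+h_j} ∏_{j'=1}^{ℓ'} 1_{d'_{j'}∣n+h'_{j'}} ≪_A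
τ(d₁⋯d'_{ℓ'})^{O(1)}/(d₁⋯d'_{ℓ'} log^k R) ∫₁^∞ (∏_{p∣d₁⋯d_k} min(σ log_R p, 1)) dσ/σ^A + R^{2k}/x`
for any `A > 0`." Its proof begins: "By (2.14), the left-hand side of (3.18) may be expanded as
`∑_{d'₁,d''₁,…,d'_k,d''_k} 𝔼_{n ≤ x} ∏_{j=1}^k μψ_{≤R}(d'_j) μψ_{≤R}(d''_j) ∏_{j=1}^{k'} 1_{d*_j∣n+h_j}`
where `d*_j := [d_j,d'_j,d''_j]` … From Lemma 3.3 we see that the average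
`𝔼_{n ≤ x} ∏ 1_{d*_j∣n+h_j}` vanishes unless `(d*_i,d*_j)∣h_i-h_j` for all `1 ≤ i < j ≤ k'`, in which
case it is equal to `1/[d*₁,…,d*_{k'}] + O(1/x)`. The contribution of the error `O(1/x)` is of size
`O(R^{2k}/x)`". [cite: TaoTeravainen2021, Lemma 3.4 and its proof (first two displays); Lemma 3.3]

This file formalises exactly this first step at `k = 2` (shifts `h₁, h₂`, moduli `d₀ ∣ n+h₁`,
`d₁ ∣ n+h₂`), for the smoothed Selberg sieve `ν = selbergSieve ψ R` of the tree:

* `sieveWt ψ R e = λ_e = μ(e) ψ_{≤R}(e)` and the fixed index range `sieveRange R = [1, ⌈R⌉)`;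
  `selbergSieve_eq_sq` — `ν(m) = (∑_{e ∈ E} λ_e 1_{e∣m})²` (`λ_e = 0` for `e ≥ R`);
* the four slots `(e₁, e₁', e₂, e₂')` (`Fin 4`, sides `slotSide = ![0,0,1,1]`) and the moduli
  `tupleModulus d t j = d*_j = [d_j, e_j, e'_j]`; `selbergSieve_pair_expand` —
  `ν(m₀)1_{d₀∣m₀} ν(m₁)1_{d₁∣m₁} = ∑_{t ∈ E⁴} (∏_k λ_{t_k}) 1_{d*₀∣m₀} 1_{d*₁∣m₁}`;
* `crtDensity h₁ h₂ L₀ L₁ = 1_{(L₀,L₁)∣h₁-h₂}/[L₀,L₁]` and `abs_card_filter_dvd_dvd_sub_le` — Lemma 3.3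
  with the count: `|#{1 ≤ n ≤ x : L₀∣n+h₁, L₁∣n+h₂} - x·crtDensity| ≤ 1` (Mathlib's
  `Nat.chineseRemainder'` and the tree's `abs_card_Ioc_filter_modEq_sub_le`);
* `sieveCorrelation` (`S(d₀,d₁) = ∑_{n ≤ x} ν(n+h₁)1_{d₀∣n+h₁}ν(n+h₂)1_{d₁∣n+h₂}`, i.e. `x` times
  the left side of (3.18)), `sieveMainSum` (`Σ = ∑_{t∈E⁴} (∏λ) crtDensity(d*₀,d*₁)`) and
  `abs_sieveCorrelation_sub_le` — `|S - xΣ| ≤ (B⌈R⌉)⁴` for `|ψ| ≤ B` (the `O(R^{2k})` error).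
-/

noncomputable section

open Finset
open scoped ArithmeticFunction.Moebius

namespace Literature.Barriers.Parity

namespace TaoTeravainen

/-! ### The sieve weights `λ_e = μ(e) ψ_{≤R}(e)` on the fixed range `1 ≤ e < ⌈R⌉` -/

/-- The Selberg sieve coefficient `λ_e := μ(e) ψ_{≤R}(e)` of (2.14) (`ν = (∑_{e ∣ n} λ_e)²`).
[cite: TaoTeravainen2021, §2.5 (2.14)] -/
def sieveWt (ψ : ℝ → ℝ) (R : ℝ) (e : ℕ) : ℝ :=
  (μ e : ℝ) * cutoffLE ψ R e

/-- The index range `E = {1 ≤ e < ⌈R⌉}` carrying the support of `λ`. [cite: TaoTeravainen2021, §2.5 (2.14)] -/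
def sieveRange (R : ℝ) : Finset ℕ :=
  Finset.Ico 1 ⌈R⌉₊

/-- Membership in the index range. [folklore] -/
theorem mem_sieveRange {R : ℝ} {e : ℕ} : e ∈ sieveRange R ↔ 1 ≤ e ∧ (e : ℝ) < R := by
  rw [sieveRange, Finset.mem_Ico, Nat.lt_ceil]

/-- `λ_e = 0` for `e ≥ R` (`R > 1`). [cite: TaoTeravainen2021, §2.5 (2.12), (2.14)] -/
theorem sieveWt_eq_zero_of_le {ψ : ℝ → ℝ} (hψ : IsSmoothCutoff ψ) {R : ℝ} (hR : 1 < R) {e : ℕ}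
    (he : R ≤ e) : sieveWt ψ R e = 0 := by
  rw [sieveWt, cutoffLE_eq_zero_of_le hψ hR he, mul_zero]

/-- `|λ_e| ≤ B` when `|ψ| ≤ B`. [folklore] -/
theorem abs_sieveWt_le {ψ : ℝ → ℝ} {B : ℝ} (hB : ∀ u : ℝ, |ψ u| ≤ B) (R : ℝ) (e : ℕ) :
    |sieveWt ψ R e| ≤ B := by
  rw [sieveWt, abs_mul]
  have h1 : |(μ e : ℝ)| ≤ 1 := by exact_mod_cast ArithmeticFunction.abs_moebius_le_one
  have h2 : |cutoffLE ψ R e| ≤ B := hB _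
  have hB0 : 0 ≤ B := (abs_nonneg _).trans (hB 0)
  calc |(μ e : ℝ)| * |cutoffLE ψ R e| ≤ 1 * B :=
        mul_le_mul h1 h2 (abs_nonneg _) zero_le_one
    _ = B := one_mul B

/-- **The divisor sum over the fixed range**: for `m ≥ 1` and `R > 1`,
`∑_{e ∣ m} μ(e) ψ_{≤R}(e) = ∑_{e ∈ E} λ_e 1_{e ∣ m}`. [cite: TaoTeravainen2021, §2.5 (2.14)] -/
theorem sum_divisors_eq_sum_sieveRange {ψ : ℝ → ℝ} (hψ : IsSmoothCutoff ψ) {R : ℝ} (hR : 1 < R)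
    {m : ℕ} (hm : m ≠ 0) :
    ∑ e ∈ m.divisors, (μ e : ℝ) * cutoffLE ψ R e =
      ∑ e ∈ sieveRange R, (if e ∣ m then sieveWt ψ R e else 0) := by
  classical
  rw [← Finset.sum_filter]
  -- both sides are the sum of `λ` over the divisors `e < R`
  have hsub : (sieveRange R).filter (fun e => e ∣ m) ⊆ m.divisors := by
    intro e he
    rw [Finset.mem_filter] at he
    exact Nat.mem_divisors.mpr ⟨he.2, hm⟩
  symm
  refine Finset.sum_subset hsub fun e he hne => ?_
  -- a divisor outside the range has `e ≥ R`, where `λ_e = 0`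
  have he1 : 1 ≤ e := Nat.pos_of_mem_divisors he
  have hed : e ∣ m := Nat.dvd_of_mem_divisors he
  have hRe : R ≤ e := by
    by_contra h
    push Not at h
    exact hne (Finset.mem_filter.mpr ⟨mem_sieveRange.mpr ⟨he1, h⟩, hed⟩)
  exact sieveWt_eq_zero_of_le hψ hR hRe

/-- **`ν` over the fixed range**: `ν(m) = (∑_{e ∈ E} λ_e 1_{e ∣ m})²` for `m ≥ 1`.
[cite: TaoTeravainen2021, §2.5 (2.14)] -/
theorem selbergSieve_eq_sq {ψ : ℝ → ℝ} (hψ : IsSmoothCutoff ψ) {R : ℝ} (hR : 1 < R)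
    {m : ℕ} (hm : m ≠ 0) :
    selbergSieve ψ R m = (∑ e ∈ sieveRange R, (if e ∣ m then sieveWt ψ R e else 0)) ^ 2 := by
  rw [selbergSieve, sum_divisors_eq_sum_sieveRange hψ hR hm]

/-! ### The `k = 2` expansion: tuples indexed by the four slots -/

/-- The side (`0` for `n + h₁`, `1` for `n + h₂`) of each of the four slots
`(e₁, e₁', e₂, e₂')` of the expanded correlation `ν(n+h₁)ν(n+h₂)`. [cite: TaoTeravainen2021, §3.2 (proof of Lemma 3.4)] -/
def slotSide : Fin 4 → Fin 2 := ![0, 0, 1, 1]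

/-- Slot `0` (`e₁`) is on side `0`. [folklore] -/
@[simp] theorem slotSide_zero : slotSide 0 = 0 := rfl

/-- Slot `1` (`e₁'`) is on side `0`. [folklore] -/
@[simp] theorem slotSide_one : slotSide 1 = 0 := rfl

/-- Slot `2` (`e₂`) is on side `1`. [folklore] -/
@[simp] theorem slotSide_two : slotSide 2 = 1 := rfl

/-- Slot `3` (`e₂'`) is on side `1`. [folklore] -/
@[simp] theorem slotSide_three : slotSide 3 = 1 := rfl

/-- **The moduli `d*_j = [d_j, e_j, e'_j]`** of the expanded correlation ("where
`d_j^* := [d_j, d'_j, d''_j]`"): side `0` collects the slots `0, 1`, side `1` the slots `2, 3`.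
[cite: TaoTeravainen2021, §3.2 (proof of Lemma 3.4)] -/
def tupleModulus (d : Fin 2 → ℕ) (t : Fin 4 → ℕ) (j : Fin 2) : ℕ :=
  if j = 0 then Nat.lcm (d 0) (Nat.lcm (t 0) (t 1)) else Nat.lcm (d 1) (Nat.lcm (t 2) (t 3))

/-- `d*_0 = [d₀, e₀, e₁]`. [cite: TaoTeravainen2021, §3.2 (proof of Lemma 3.4)] -/
theorem tupleModulus_zero (d : Fin 2 → ℕ) (t : Fin 4 → ℕ) :
    tupleModulus d t 0 = Nat.lcm (d 0) (Nat.lcm (t 0) (t 1)) := rfl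

/-- `d*_1 = [d₁, e₂, e₃]`. [cite: TaoTeravainen2021, §3.2 (proof of Lemma 3.4)] -/
theorem tupleModulus_one (d : Fin 2 → ℕ) (t : Fin 4 → ℕ) :
    tupleModulus d t 1 = Nat.lcm (d 1) (Nat.lcm (t 2) (t 3)) := by
  simp [tupleModulus]

/-- `d*_0 ∣ m ↔ d₀, e₀, e₁ ∣ m`. [folklore] -/
theorem tupleModulus_zero_dvd_iff (d : Fin 2 → ℕ) (t : Fin 4 → ℕ) (m : ℕ) :
    tupleModulus d t 0 ∣ m ↔ d 0 ∣ m ∧ t 0 ∣ m ∧ t 1 ∣ m := by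
  rw [tupleModulus_zero, Nat.lcm_dvd_iff, Nat.lcm_dvd_iff]

/-- `d*_1 ∣ m ↔ d₁, e₂, e₃ ∣ m`. [folklore] -/
theorem tupleModulus_one_dvd_iff (d : Fin 2 → ℕ) (t : Fin 4 → ℕ) (m : ℕ) :
    tupleModulus d t 1 ∣ m ↔ d 1 ∣ m ∧ t 2 ∣ m ∧ t 3 ∣ m := by
  rw [tupleModulus_one, Nat.lcm_dvd_iff, Nat.lcm_dvd_iff]

/-- `d*_j ≥ 1` when `d_j ≥ 1` and the slots are `≥ 1`. [folklore] -/
theorem tupleModulus_pos {d : Fin 2 → ℕ} {t : Fin 4 → ℕ} (hd : ∀ j, 0 < d j) (ht : ∀ k, 0 < t k)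
    (j : Fin 2) : 0 < tupleModulus d t j := by
  fin_cases j
  · rw [show ((⟨0, by norm_num⟩ : Fin 2)) = 0 from rfl, tupleModulus_zero]
    exact Nat.lcm_pos (hd 0) (Nat.lcm_pos (ht 0) (ht 1))
  · rw [show ((⟨1, by norm_num⟩ : Fin 2)) = 1 from rfl, tupleModulus_one]
    exact Nat.lcm_pos (hd 1) (Nat.lcm_pos (ht 2) (ht 3))

/-- **Expanding `ν(m₀) 1_{d₀∣m₀} ν(m₁) 1_{d₁∣m₁}` over the four slots** ("By (2.14), the
left-hand side of (3.18) may be expanded as `∑_{d'₁,d''₁,…} 𝔼 ∏ μψ_{≤R}(d'_j) μψ_{≤R}(d''_j)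
∏ 1_{d*_j ∣ n+h_j}`"): for `m₀, m₁ ≥ 1`,
`ν(m₀) 1_{d₀∣m₀} ν(m₁) 1_{d₁∣m₁} = ∑_{t ∈ E⁴} (∏_k λ_{t_k}) 1_{d*_0(t) ∣ m₀} 1_{d*_1(t) ∣ m₁}`.
[cite: TaoTeravainen2021, §3.2 (proof of Lemma 3.4, first display)] -/
theorem selbergSieve_pair_expand {ψ : ℝ → ℝ} (hψ : IsSmoothCutoff ψ) {R : ℝ} (hR : 1 < R)
    (d : Fin 2 → ℕ) {m : Fin 2 → ℕ} (hm : ∀ j, m j ≠ 0) :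
    (selbergSieve ψ R (m 0) * (if d 0 ∣ m 0 then 1 else 0)) *
        (selbergSieve ψ R (m 1) * (if d 1 ∣ m 1 then 1 else 0)) =
      ∑ t ∈ Fintype.piFinset (fun _ : Fin 4 => sieveRange R),
        (∏ k, sieveWt ψ R (t k)) *
          ((if tupleModulus d t 0 ∣ m 0 then 1 else 0) * (if tupleModulus d t 1 ∣ m 1 then 1 else 0)) := by
  classical
  set E := sieveRange R with hE
  set a : Fin 4 → ℕ → ℝ := fun k e => if e ∣ m (slotSide k) then sieveWt ψ R e else 0 with ha
  -- the product of the four slot sums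
  have hprod : (selbergSieve ψ R (m 0)) * (selbergSieve ψ R (m 1)) = ∏ k : Fin 4, ∑ e ∈ E, a k e := by
    rw [Fin.prod_univ_four, selbergSieve_eq_sq hψ hR (hm 0), selbergSieve_eq_sq hψ hR (hm 1)]
    simp only [ha, slotSide_zero, slotSide_one, slotSide_two, slotSide_three, hE]
    ring
  have hexp : ∏ k : Fin 4, ∑ e ∈ E, a k e =
      ∑ t ∈ Fintype.piFinset (fun _ : Fin 4 => E), ∏ k, a k (t k) :=
    Finset.prod_univ_sum (fun _ => E) a
  calc (selbergSieve ψ R (m 0) * (if d 0 ∣ m 0 then 1 else 0)) *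
        (selbergSieve ψ R (m 1) * (if d 1 ∣ m 1 then 1 else 0))
      = (selbergSieve ψ R (m 0) * selbergSieve ψ R (m 1)) *
          ((if d 0 ∣ m 0 then (1 : ℝ) else 0) * (if d 1 ∣ m 1 then 1 else 0)) := by ring
    _ = (∑ t ∈ Fintype.piFinset (fun _ : Fin 4 => E), ∏ k, a k (t k)) *
          ((if d 0 ∣ m 0 then (1 : ℝ) else 0) * (if d 1 ∣ m 1 then 1 else 0)) := by rw [hprod, hexp]
    _ = ∑ t ∈ Fintype.piFinset (fun _ : Fin 4 => E), (∏ k, a k (t k)) *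
          ((if d 0 ∣ m 0 then (1 : ℝ) else 0) * (if d 1 ∣ m 1 then 1 else 0)) := by
        rw [Finset.sum_mul]
    _ = _ := by
        refine Finset.sum_congr rfl fun t _ => ?_
        -- compare the two products slot by slot
        simp only [ha, Fin.prod_univ_four, slotSide_zero, slotSide_one, slotSide_two,
          slotSide_three]
        by_cases h0 : tupleModulus d t 0 ∣ m 0
        · by_cases h1 : tupleModulus d t 1 ∣ m 1
          · rw [if_pos h0, if_pos h1]
            rw [tupleModulus_zero_dvd_iff] at h0
            rw [tupleModulus_one_dvd_iff] at h1
            rw [if_pos h0.2.1, if_pos h0.2.2, if_pos h1.2.1, if_pos h1.2.2, if_pos h0.1, if_pos h1.1]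
          · rw [if_neg h1, mul_zero, mul_zero]
            rw [tupleModulus_one_dvd_iff] at h1
            by_cases hd1 : d 1 ∣ m 1
            · by_cases h2 : t 2 ∣ m 1
              · have h3 : ¬ t 3 ∣ m 1 := fun h3 => h1 ⟨hd1, h2, h3⟩
                rw [if_neg h3]
                ring
              · rw [if_neg h2]
                ring
            · rw [if_neg hd1]
              ring
        · rw [if_neg h0, zero_mul, mul_zero]
          rw [tupleModulus_zero_dvd_iff] at h0
          by_cases hd0 : d 0 ∣ m 0
          · by_cases h2 : t 0 ∣ m 0
            · have h3 : ¬ t 1 ∣ m 0 := fun h3 => h0 ⟨hd0, h2, h3⟩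
              rw [if_neg h3]
              ring
            · rw [if_neg h2]
              ring
          · rw [if_neg hd0]
            ring

/-! ### The Chinese remainder theorem for two shifted congruences (Lemma 3.3 at `k' = 2`) -/

/-- The compatibility indicator `1_{(L₀, L₁) ∣ h₀ - h₁}` times `1/[L₀, L₁]`: the density of
`{n : L₀ ∣ n + h₀, L₁ ∣ n + h₁}` (Lemma 3.3 (ii): "there is a unique residue class `a ([d₁, d₂])`").
[cite: TaoTeravainen2021, Lemma 3.3] -/
def crtDensity (h₀ h₁ L₀ L₁ : ℕ) : ℝ :=
  if ((Nat.gcd L₀ L₁ : ℕ) : ℤ) ∣ (h₀ : ℤ) - h₁ then 1 / (Nat.lcm L₀ L₁ : ℝ) else 0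

/-- `0 ≤ crtDensity ≤ 1/[L₀, L₁]`. [folklore] -/
theorem crtDensity_nonneg (h₀ h₁ L₀ L₁ : ℕ) : 0 ≤ crtDensity h₀ h₁ L₀ L₁ := by
  unfold crtDensity
  split_ifs <;> positivity

/-- **Lemma 3.3 for two congruences, with the count**: for `L₀, L₁ ≥ 1`,
`|#{1 ≤ n ≤ x : L₀ ∣ n + h₀, L₁ ∣ n + h₁} - x · 1_{(L₀,L₁) ∣ h₀ - h₁}/[L₀, L₁]| ≤ 1` (the two
congruences are compatible iff `(L₀, L₁) ∣ h₀ - h₁`, and then form one class modulo `[L₀, L₁]`,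
which meets `(0, x]` in `x/[L₀,L₁] + O(1)` points — the tree's `abs_card_Ioc_filter_modEq_sub_le`).
[cite: TaoTeravainen2021, Lemma 3.3 (ii) and proof of Lemma 3.4 ("equal to `1/[d*₁,…,d*_{k'}] + O(1/x)`")] -/
theorem abs_card_filter_dvd_dvd_sub_le (x h₀ h₁ : ℕ) {L₀ L₁ : ℕ} (hL₀ : 0 < L₀) (hL₁ : 0 < L₁) :
    |(#((Icc 1 x).filter fun n : ℕ => L₀ ∣ n + h₀ ∧ L₁ ∣ n + h₁) : ℝ) -
        x * crtDensity h₀ h₁ L₀ L₁| ≤ 1 := by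
  classical
  set g := Nat.gcd L₀ L₁ with hg
  have hg0 : 0 < g := Nat.gcd_pos_of_pos_left _ hL₀
  unfold crtDensity
  by_cases hc : ((g : ℕ) : ℤ) ∣ (h₀ : ℤ) - h₁
  · rw [if_pos hc]
    -- the residues `aⱼ ≡ -hⱼ (mod Lⱼ)`
    set a₀ : ℕ := L₀ - h₀ % L₀ with ha₀
    set a₁ : ℕ := L₁ - h₁ % L₁ with ha₁
    have hdiv₀ : L₀ ∣ a₀ + h₀ := by
      have hmod := Nat.div_add_mod h₀ L₀
      have hlt : h₀ % L₀ < L₀ := Nat.mod_lt _ hL₀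
      have : a₀ + h₀ = L₀ + L₀ * (h₀ / L₀) := by rw [ha₀]; omega
      rw [this]
      exact dvd_add dvd_rfl (dvd_mul_right _ _)
    have hdiv₁ : L₁ ∣ a₁ + h₁ := by
      have hmod := Nat.div_add_mod h₁ L₁
      have hlt : h₁ % L₁ < L₁ := Nat.mod_lt _ hL₁
      have : a₁ + h₁ = L₁ + L₁ * (h₁ / L₁) := by rw [ha₁]; omega
      rw [this]
      exact dvd_add dvd_rfl (dvd_mul_right _ _)
    -- compatibility `a₀ ≡ a₁ (mod g)`
    have hcompat : a₀ ≡ a₁ [MOD g] := by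
      have h1 : a₀ + h₀ ≡ 0 [MOD g] :=
        Nat.modEq_zero_iff_dvd.mpr ((Nat.gcd_dvd_left L₀ L₁).trans hdiv₀)
      have h2 : a₁ + h₁ ≡ 0 [MOD g] :=
        Nat.modEq_zero_iff_dvd.mpr ((Nat.gcd_dvd_right L₀ L₁).trans hdiv₁)
      have h3 : h₁ ≡ h₀ [MOD g] := Nat.modEq_iff_dvd.mpr hc
      have h4 : a₀ + h₀ ≡ a₁ + h₀ [MOD g] :=
        h1.trans (h2.symm.trans (Nat.ModEq.add_left a₁ h3))
      exact Nat.ModEq.add_right_cancel' h₀ h4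
    obtain ⟨r, hr₀, hr₁⟩ := Nat.chineseRemainder' hcompat
    set Lc := Nat.lcm L₀ L₁ with hLc
    have hLc0 : 0 < Lc := Nat.lcm_pos hL₀ hL₁
    -- the filter is the class of `r` modulo `[L₀, L₁]`
    have hfilt : ((Icc 1 x).filter fun n : ℕ => L₀ ∣ n + h₀ ∧ L₁ ∣ n + h₁) =
        (Ioc 0 x).filter fun n : ℕ => n ≡ r [MOD Lc] := by
      have hIcc : (Icc 1 x : Finset ℕ) = Ioc 0 x := rfl
      rw [hIcc]
      refine Finset.filter_congr fun n _ => ?_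
      constructor
      · rintro ⟨hn₀, hn₁⟩
        -- `n ≡ r` modulo `L₀` and `L₁`, hence modulo the lcm
        have e₀ : n ≡ r [MOD L₀] :=
          Nat.ModEq.add_right_cancel' h₀
            ((Nat.modEq_zero_iff_dvd.mpr hn₀).trans
              ((Nat.modEq_zero_iff_dvd.mpr hdiv₀).symm.trans (Nat.ModEq.add_right h₀ hr₀.symm)))
        have e₁ : n ≡ r [MOD L₁] :=
          Nat.ModEq.add_right_cancel' h₁
            ((Nat.modEq_zero_iff_dvd.mpr hn₁).trans
              ((Nat.modEq_zero_iff_dvd.mpr hdiv₁).symm.trans (Nat.ModEq.add_right h₁ hr₁.symm)))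
        rw [Nat.modEq_iff_dvd] at e₀ e₁ ⊢
        rw [hLc, Int.natCast_dvd]
        exact Nat.lcm_dvd (Int.natCast_dvd.mp e₀) (Int.natCast_dvd.mp e₁)
      · intro hn
        have e₀ : n ≡ r [MOD L₀] := Nat.ModEq.of_dvd (Nat.dvd_lcm_left L₀ L₁) hn
        have e₁ : n ≡ r [MOD L₁] := Nat.ModEq.of_dvd (Nat.dvd_lcm_right L₀ L₁) hn
        constructor
        · exact Nat.modEq_zero_iff_dvd.mp
            ((Nat.ModEq.add_right h₀ (e₀.trans hr₀)).trans (Nat.modEq_zero_iff_dvd.mpr hdiv₀))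
        · exact Nat.modEq_zero_iff_dvd.mp
            ((Nat.ModEq.add_right h₁ (e₁.trans hr₁)).trans (Nat.modEq_zero_iff_dvd.mpr hdiv₁))
    rw [hfilt, mul_one_div]
    exact Literature.NumberTheory.Sieve.abs_card_Ioc_filter_modEq_sub_le hLc0 x r
  · rw [if_neg hc, mul_zero, sub_zero]
    have hempty : ((Icc 1 x).filter fun n : ℕ => L₀ ∣ n + h₀ ∧ L₁ ∣ n + h₁) = ∅ := by
      refine Finset.filter_eq_empty_iff.mpr fun n _ hn => hc ?_
      obtain ⟨hn₀, hn₁⟩ := hn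
      have h1 : (g : ℤ) ∣ ((n + h₀ : ℕ) : ℤ) := by
        exact_mod_cast (Nat.gcd_dvd_left L₀ L₁).trans hn₀
      have h2 : (g : ℤ) ∣ ((n + h₁ : ℕ) : ℤ) := by
        exact_mod_cast (Nat.gcd_dvd_right L₀ L₁).trans hn₁
      have h3 := dvd_sub h1 h2
      push_cast at h3
      have : (n : ℤ) + h₀ - (n + h₁) = (h₀ : ℤ) - h₁ := by ring
      rwa [this] at h3
    rw [hempty, Finset.card_empty, Nat.cast_zero, abs_zero]
    exact zero_le_one

/-! ### The correlation sum and its main term -/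

/-- **The constrained correlation of Lemma 3.4 at `k = 2`, `ℓ' = 0`**:
`S(d₀, d₁) = ∑_{1 ≤ n ≤ x} ν(n+h₁) 1_{d₀ ∣ n+h₁} ν(n+h₂) 1_{d₁ ∣ n+h₂}` (`x 𝔼_{n ≤ x}` of the
left-hand side of (3.18)). [cite: TaoTeravainen2021, Lemma 3.4 (3.18)] -/
def sieveCorrelation (ψ : ℝ → ℝ) (R : ℝ) (h₁ h₂ : ℕ) (d : Fin 2 → ℕ) (x : ℕ) : ℝ :=
  ∑ n ∈ Icc 1 x, (selbergSieve ψ R (n + h₁) * (if d 0 ∣ n + h₁ then 1 else 0)) *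
    (selbergSieve ψ R (n + h₂) * (if d 1 ∣ n + h₂ then 1 else 0))

/-- **The main term of the expansion** ("it suffices to show that
`∑_{d'₁,d''₁,…} ∏ μψ_{≤R}(d'_j)μψ_{≤R}(d''_j) ∏_{i<j} 1_{(d*_i,d*_j)∣h_i-h_j}/[d*₁,…,d*_{k'}] ≪ …`"):
`Σ(d₀, d₁) = ∑_{t ∈ E⁴} (∏_k λ_{t_k}) 1_{(d*₀,d*₁) ∣ h₁-h₂}/[d*₀, d*₁]`.
[cite: TaoTeravainen2021, §3.2 (proof of Lemma 3.4, second display)] -/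
def sieveMainSum (ψ : ℝ → ℝ) (R : ℝ) (h₁ h₂ : ℕ) (d : Fin 2 → ℕ) : ℝ :=
  ∑ t ∈ Fintype.piFinset (fun _ : Fin 4 => sieveRange R),
    (∏ k, sieveWt ψ R (t k)) * crtDensity h₁ h₂ (tupleModulus d t 0) (tupleModulus d t 1)

/-- **The expansion with the Chinese remainder theorem**: for `d₀, d₁ ≥ 1`, `R > 1` and `|ψ| ≤ B`,
`|S(d₀,d₁) - x Σ(d₀,d₁)| ≤ (B ⌈R⌉)⁴` ("The contribution of the error `O(1/x)` is of size
`O(R^{2k}/x)`"). [cite: TaoTeravainen2021, §3.2 (proof of Lemma 3.4)] -/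
theorem abs_sieveCorrelation_sub_le {ψ : ℝ → ℝ} (hψ : IsSmoothCutoff ψ) {B : ℝ}
    (hB : ∀ u : ℝ, |ψ u| ≤ B) {R : ℝ} (hR : 1 < R) (h₁ h₂ : ℕ) {d : Fin 2 → ℕ} (hd : ∀ j, 0 < d j)
    (x : ℕ) :
    |sieveCorrelation ψ R h₁ h₂ d x - x * sieveMainSum ψ R h₁ h₂ d| ≤ (B * ⌈R⌉₊) ^ 4 := by
  classical
  set E := sieveRange R with hE
  set T := Fintype.piFinset (fun _ : Fin 4 => E) with hT
  have hB0 : 0 ≤ B := (abs_nonneg _).trans (hB 0)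
  -- expand and exchange the sums
  have hexp : sieveCorrelation ψ R h₁ h₂ d x =
      ∑ t ∈ T, (∏ k, sieveWt ψ R (t k)) *
        (#((Icc 1 x).filter fun n : ℕ =>
            tupleModulus d t 0 ∣ n + h₁ ∧ tupleModulus d t 1 ∣ n + h₂) : ℝ) := by
    unfold sieveCorrelation
    have hstep : ∀ n ∈ Icc 1 x,
        (selbergSieve ψ R (n + h₁) * (if d 0 ∣ n + h₁ then 1 else 0)) *
          (selbergSieve ψ R (n + h₂) * (if d 1 ∣ n + h₂ then 1 else 0)) =
        ∑ t ∈ T, (∏ k, sieveWt ψ R (t k)) *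
          ((if tupleModulus d t 0 ∣ n + h₁ then 1 else 0) *
            (if tupleModulus d t 1 ∣ n + h₂ then 1 else 0)) := by
      intro n hn
      rw [Finset.mem_Icc] at hn
      have := selbergSieve_pair_expand hψ hR d (m := ![n + h₁, n + h₂])
        (fun j => by fin_cases j <;> simp <;> omega)
      simpa using this
    rw [Finset.sum_congr rfl hstep, Finset.sum_comm]
    refine Finset.sum_congr rfl fun t _ => ?_
    rw [← Finset.mul_sum]
    congr 1
    rw [← Finset.sum_boole]
    refine Finset.sum_congr rfl fun n _ => ?_
    by_cases h0 : tupleModulus d t 0 ∣ n + h₁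
    · by_cases h1' : tupleModulus d t 1 ∣ n + h₂
      · rw [if_pos h0, if_pos h1', if_pos ⟨h0, h1'⟩, one_mul]
      · rw [if_neg h1', mul_zero, if_neg fun h => h1' h.2]
    · rw [if_neg h0, zero_mul, if_neg fun h => h0 h.1]
  -- subtract the main term tuple by tuple
  rw [hexp, sieveMainSum, Finset.mul_sum, ← Finset.sum_sub_distrib]
  have hterm : ∀ t ∈ T,
      |(∏ k, sieveWt ψ R (t k)) *
          (#((Icc 1 x).filter fun n : ℕ =>
              tupleModulus d t 0 ∣ n + h₁ ∧ tupleModulus d t 1 ∣ n + h₂) : ℝ) -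
        x * ((∏ k, sieveWt ψ R (t k)) * crtDensity h₁ h₂ (tupleModulus d t 0) (tupleModulus d t 1))|
        ≤ B ^ 4 := by
    intro t ht
    have htk : ∀ k, 0 < t k := fun k => by
      have := Fintype.mem_piFinset.mp ht k
      rw [hE, mem_sieveRange] at this
      exact this.1
    have h1 := abs_card_filter_dvd_dvd_sub_le x h₁ h₂ (tupleModulus_pos hd htk 0)
      (tupleModulus_pos hd htk 1)
    rw [show (∏ k, sieveWt ψ R (t k)) *
          (#((Icc 1 x).filter fun n : ℕ =>
              tupleModulus d t 0 ∣ n + h₁ ∧ tupleModulus d t 1 ∣ n + h₂) : ℝ) -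
        x * ((∏ k, sieveWt ψ R (t k)) * crtDensity h₁ h₂ (tupleModulus d t 0) (tupleModulus d t 1)) =
        (∏ k, sieveWt ψ R (t k)) *
          ((#((Icc 1 x).filter fun n : ℕ =>
              tupleModulus d t 0 ∣ n + h₁ ∧ tupleModulus d t 1 ∣ n + h₂) : ℝ) -
            x * crtDensity h₁ h₂ (tupleModulus d t 0) (tupleModulus d t 1)) by ring, abs_mul]
    have hprod : |∏ k, sieveWt ψ R (t k)| ≤ B ^ 4 := by
      rw [Finset.abs_prod]
      calc ∏ k, |sieveWt ψ R (t k)| ≤ ∏ _k : Fin 4, B :=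
            Finset.prod_le_prod (fun k _ => abs_nonneg _) fun k _ => abs_sieveWt_le hB R (t k)
        _ = B ^ 4 := by simp
    calc |∏ k, sieveWt ψ R (t k)| * _ ≤ B ^ 4 * 1 :=
          mul_le_mul hprod h1 (abs_nonneg _) (by positivity)
      _ = B ^ 4 := mul_one _
  calc |∑ t ∈ T, ((∏ k, sieveWt ψ R (t k)) *
          (#((Icc 1 x).filter fun n : ℕ =>
              tupleModulus d t 0 ∣ n + h₁ ∧ tupleModulus d t 1 ∣ n + h₂) : ℝ) -
            x * ((∏ k, sieveWt ψ R (t k)) *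
              crtDensity h₁ h₂ (tupleModulus d t 0) (tupleModulus d t 1)))|
      ≤ ∑ t ∈ T, |(∏ k, sieveWt ψ R (t k)) *
          (#((Icc 1 x).filter fun n : ℕ =>
              tupleModulus d t 0 ∣ n + h₁ ∧ tupleModulus d t 1 ∣ n + h₂) : ℝ) -
            x * ((∏ k, sieveWt ψ R (t k)) *
              crtDensity h₁ h₂ (tupleModulus d t 0) (tupleModulus d t 1))| :=
        Finset.abs_sum_le_sum_abs _ _
    _ ≤ ∑ _t ∈ T, B ^ 4 := Finset.sum_le_sum hterm
    _ = #T * B ^ 4 := by rw [Finset.sum_const, nsmul_eq_mul]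
    _ ≤ (⌈R⌉₊ : ℝ) ^ 4 * B ^ 4 := by
        refine mul_le_mul_of_nonneg_right ?_ (by positivity)
        rw [hT, Fintype.card_piFinset, Finset.prod_const, Finset.card_univ, Fintype.card_fin]
        have : #E ≤ ⌈R⌉₊ := by
          rw [hE, sieveRange, Nat.card_Ico]
          omega
        exact_mod_cast Nat.pow_le_pow_left this 4
    _ = (B * ⌈R⌉₊) ^ 4 := by ring

end TaoTeravainen

end Literature.Barriers.Parity
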